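import Mathlib.Analysis.Calculus.ContDiff.Basic
import Mathlib.Analysis.SpecialFunctions.Pow.Real
import Mathlib.MeasureTheory.Integral.Lebesgue.Basic
import Mathlib.MeasureTheory.Measure.Haar.InnerProductSpace
import Mathlib.Data.Finset.Fold
import Literature.Geometry.Lorentzian.KerrConvergence
import Literature.Geometry.Lorentzian.ShellDeviation
import HarnessLib

/-!
# The initial-layer norm of a vacuum region relative to a receding multi-Kerr configuration

Definition request `defn-RecedingKerrInitialLayerNorm` (route FinalStateConjecture/EIHFluxBalance;
gives Lean signatures to its informal cruxes `RecedingBasinStability`, `CoerciveModulatedEnergy`,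
`MovingBackgroundBoundedness`). The requester's words: *"the one-time ("Cauchy-type") closeness of
a vacuum spacetime region to a receding multi-Kerr configuration … Data: `N`, sub-extremal
`(Mᵢ, aᵢ)`, Lorentz motions `Λᵢ`, centres `ξᵢ ∈ E3`, a lab time `τ`, a scale `ℓ`; the reference
form on `E4` is the superposed boosted Kerr–Schild ansatz `G = η + Σᵢ (boostedKerrBilin Λᵢ (τ, ξᵢ)
Mᵢ aᵢ − η)`; the initial layer is the hyperboloidal shell
`𝓛 = {x ∈ E4 : 0 < x⁰ − τ − (√(ℓ² + |x̲|²) − ℓ) < ℓ}` minus the cores `{rᵢ ≤ (r₊+r₋)/2}`; for a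
chart `Φ : 𝓛 → M` the norm `𝔑(Φ)` is the sum of (a) the near/intermediate `Cᵏ` sup norm
`Σ_{m≤k} sup σ^m |D^m(Φ^*g − G)|` with `σ = min(ℓ, min Mᵢ)` on `𝓛 ∩ {|x̲| ≤ ℓ}`, (b) the
`r^p`-weighted good-derivative flux of `ψ = r(Φ^*g − G)` through the outgoing part `𝓛 ∩ {|x̲| ≥ ℓ}`:
`∫ r^p |L ψ|² + |∇̸ψ|² + r^{-2}|ψ|²` (`L = ∂₀ + ∂_r` the `η`-outgoing null direction, `p ∈ (1, 2)`)
in the form of the Dafermos–Rodnianski `r^p` hierarchy, and (c) the transversal energy flux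
`∫ |L̲ ψ|² r^{-1-δ}` … The definition writer chooses `k, p, δ` (… or existentially quantified
exponents as in `Stability.lean`'s `dataWeightedSobolevEDist` idiom)."*

## What the sources print (the templates)

* Dafermos–Rodnianski, arXiv:0910.4957, §3, identity (p-WE-Mink): for `□φ = 0` on Minkowski space
  and `ψ := rφ`, the `r^p`-weighted flux `∫_{u = const, v ≥ v₀} r^p (∂_v ψ)² sin θ dθ dφ dv`
  through outgoing null cones (`0 < p ≤ 2`), "the expected `r²` part of the volume form is now in
  fact included in the quadratic terms in `ψ`"; the final estimate (finalest) is driven by the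
  initial quantity `∫ r² (∂_v ψ)² dω dv + ∫_{Σ} J^T[φ] n` (`r^p` flux plus energy flux).
* Dafermos–Holzegel–Rodnianski–Taylor, arXiv:2104.08222, Ch. 8 ("Final formulation of the main
  result"), §§1.2–1.4 of that chapter: norms on outgoing cones are `∫∫ |ξ|² dθ dv` ("the above
  integrands are `r^{-2}` weighted with respect to the true induced volume form"), on spacetime
  regions `du dv dθ`; the energies `𝔼^{K,p}[P_{𝓘⁺}](τ) = sup_u ∫_{C_u} Σ_{|k| ≤ K-1} r^p |Ω∇̸₄ 𝔇^k Ψ|²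
  + r^{-2} |r∇̸ 𝔇^k Ψ|² + sup_v ∫_{C̲_v} |Ω∇̸₃ 𝔇^k Ψ|² + … + ∫_{𝒟} r^{-1-δ} |Ω∇̸₃ 𝔇^k Ψ|² + …` for
  the `r`-weighted almost gauge-invariant quantities `Ψ = r⁵ P` (commuted good derivative with
  weight `r^p`, angular derivatives, transversal derivative with the spacetime weight `r^{-1-δ}`).
* Klainerman–Szeftel, *Kerr stability for small angular momentum* (arXiv:2104.11857), §3.6
  "Initial layer norm": the data of the stability theorem are posed on a SPACETIME REGION
  `𝓛₀ = 𝓛_ext ∪ 𝓛_int` (the initial data layer, `𝓛_ext` unbounded in the outgoing directions) and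
  measured by `ℑ_k = sup_{𝓛_ext} {r²|Γ_g| + r|Γ_b| + r^{7/2+δ/2}(|A|+|B|)} + sup_{𝓛_int} {|Γ_g| +
  |Γ_b|} + …` with `𝔡^{≤k}` derivatives; Giorgi–Klainerman–Szeftel arXiv:2205.14808, §3 likewise.

**No printed formulation of the present notion exists** (`N ≥ 2` moving holes; the route posits
it): this file assembles the requested norm from the templates above, over the consequence-form
chart vocabulary of `KerrConvergence.lean` (deviation `Φ^* g − G` of the pulled-back metric from a
reference `ModelBackground`, extended by zero, differentiated with `iteratedFDeriv`).

## Rendering (namespace `Literature.Geometry.Lorentzian`, grouping namespace `RecedingKerr`)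

Data, unbundled in the order the consumers quantify them: masses and spins `M a : Fin N → ℝ`,
Lorentz motions `Λ : Fin N → lorentzGroup`, centres `ξ : Fin N → E3` at lab time `τ : ℝ`, the
layer scale `ℓ : ℝ`; exponents `k : ℕ` (derivatives), `p : ℝ` (the `r^p` weight), `δ : ℝ` (the
transversal weight) are parameters of the norm, as `s, δ` are of `dataWeightedSobolevEDist`
(recommended: `k ≥ 6`, `1 < p < 2`, `0 < δ`; see "Checks" below for why `p < 2`).

* `RecedingKerr.layerTime τ ℓ x = x⁰ − τ − (√(ℓ² + |x̲|²) − ℓ)`, the hyperboloidal layer time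
  `s`: its level sets `{s = s₀}` are the upper unit hyperboloids `(x⁰ − τ + ℓ − s₀)² − |x̲|² = ℓ²`
  translated in `x⁰`, spacelike and asymptotically null, through `(τ + s₀, 0)`.
* `RecedingKerr.layer M a Λ ξ τ ℓ : Opens E4`, the initial layer
  `𝓛 = {0 < s < ℓ} ∩ ⋂ᵢ {Mᵢ < rᵢ}`, `rᵢ(x) = Kerr.radius aᵢ (Λᵢ⁻¹(x − (τ, ξᵢ)))` the rest-frame
  Kerr–Schild radius of hole `i`; the excised cores are exactly the requested
  `{rᵢ ≤ (r₊ + r₋)/2}` since `(r₊ + r₋)/2 = Mᵢ` (`Kerr.rPlus_add_rMinus`,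
  `KerrStarChartBounds.lean`, not imported: only the value `Mᵢ` is used), strictly between the
  Cauchy and event horizons of a sub-extremal hole (the chart reaches inside the horizons).
* `RecedingKerr.background M a Λ ξ τ ℓ : ModelBackground` — domain `𝓛`, reference form the
  superposed boosted Kerr–Schild ansatz `G(x) = η + Σᵢ (boostedKerrBilin Λᵢ (τ, ξᵢ) Mᵢ aᵢ x − η)`
  (written inline, term for term as in the route's typed cruxes; it is the `N`-centre superposition
  with centres `cᵢ = (τ, ξᵢ)`), time function `s`, radius `|x̲|` — so that `Spacetime.deviation`,
  `Spacetime.deviationExtend` of `KerrConvergence.lean` give `h := Φ^* g − G` and its extension by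
  zero `h̃ : E4 → (E4 →L E4 →L ℝ)`, and `background.timeSlab s₀` is the hyperboloidal leaf `{s = s₀}`.
* `RecedingKerr.scale M ℓ = min(ℓ, minᵢ Mᵢ)` (`Finset.fold min`; `= ℓ` for `N = 0`).
* (a) `RecedingKerr.nearCkNorm M a Λ ξ τ ℓ k f = Σ_{m ≤ k} σ^m · sup_{x ∈ 𝓛, |x̲| ≤ ℓ} ‖D^m f(x)‖`.
* Flat null frame on `E4 ∖ {x̲ = 0}` (`Minkowski.outgoingNull = ∂₀ + ∂_r`,
  `Minkowski.ingoingNull = ∂₀ − ∂_r`, rotations `Minkowski.rotation i j = xⁱ∂_j − xʲ∂_i`) and, for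
  a function `f` into any real normed space, `Minkowski.angularGradSq f x =
  (2r²)⁻¹ Σ_{i,j} ‖df_x(Ω_{ij})‖²` (`= |∇̸f|²` for scalar `f`) and the radiation field
  `Minkowski.radiationField f = r • f` (`ψ = rφ`).
* (b) `RecedingKerr.rpFlux … k p f = Σ_{m ≤ k} σ^{2m} ℓ⁻¹ ∫_{x ∈ 𝓛, ℓ ≤ |x̲|} r⁻² (r^p ‖Lψ_m‖² +
  |∇̸ψ_m|² + r⁻²‖ψ_m‖²) d⁴x` with `ψ_m := r • D^m f` — the requested integrand, COMMUTED with `m ≤ k`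
  flat coordinate derivatives (as DHRT commute with `𝔇^k`; the weights `σ^{2m}` make the sum
  homogeneous, matching (a)), integrated over the far part of the layer against `d⁴x/(ℓ r²)`: by
  Fubini in `(s, r, ω)` (`d⁴x = ds r² dr dω` along the leaves, unit Jacobian) this is the AVERAGE
  over the leaves `{s = s₀}`, `0 < s₀ < ℓ`, of the leaf fluxes `∫ (…) dr dω` in exactly the DR/DHRT
  measure `dv dω` ("`r²` included in `ψ`"); a thickened hypersurface has no other flux. (The
  average, not the supremum over leaves: it needs no parametrisation of the leaves, and by
  Chebyshev it hands a Cauchy-stability consumer a leaf of flux `≤ 2 ×` average, while part (a)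
  is already a supremum over the whole thick near region, time derivatives included.) One
  regularity index `k` counts the COMMUTED derivatives in all three parts (as `K` in DHRT's
  `𝔼^{K,p}`, `k` in KS's `ℑ_k`): (a) sees `D^m h̃`, `m ≤ k`, and (b), (c) see the first null/angular
  derivatives of `ψ_m = r D^m h̃`, `m ≤ k` — for `k = 0` exactly the request's (b), (c), which are
  first order in `ψ = ψ₀` (so the far part involves `k + 1` derivatives of `h̃`, in flux norm).
* (c) `RecedingKerr.transversalFlux … k δ f = Σ_{m ≤ k} σ^{2m} ℓ⁻¹ ∫_{far layer} r⁻² · r^{-1-δ}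
  ‖L̲ψ_m‖² d⁴x`.
* `Spacetime.recedingKerrInitialLayerNorm 𝓢 M a Λ ξ τ ℓ k p δ Φ := (a) + (b)^{1/2} + (c)^{1/2}`
  evaluated at `f = h̃ = deviationExtend (background …) Φ`, valued in `ℝ≥0∞` (finiteness is part of
  smallness, as for `deviationCk`). The fluxes are quadratic, so they enter through square roots:
  `𝔑` is homogeneous of degree one in the deviation (the consumers' "`ε`-close in `𝔑` ⇒ modulated
  energy `O(ε²)`").

## Checks requested by the planner (informal, recorded for the reviewers)

(i) *finite and small for exact boosted Kerr plus Christodoulou–Klainerman-class perturbations*: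
for `N = 1` and `Φ` the Kerr–Schild chart of an exact boosted Kerr region, `h = 0` and `𝔑 = 0`
(`nearCkNorm_zero`, `rpFlux_zero`, `transversalFlux_zero`). For a perturbation with
`D^m h = O(r^{-q-m})` on the layer (`q = 3/2 + ε` is the CK class relative to the Kerr–Schild
skeleton, which already carries the `Mᵢ/r` monopoles), `Lψ_m, L̲ψ_m, ∇̸ψ_m = O(σ^{-m} r^{-q})`, so
the far integrands are `O(r^{p-2q})`, `O(r^{-2q})`, `O(r^{-1-δ-2q})` against `dr`: finite iff
`p < 2q − 1`, i.e. `p < 2` suffices for every `q > 3/2` — the reason for the recommended range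
`1 < p < 2` (DR's hierarchy closes for `p ≤ 2`); outgoing radiation `h ≈ F(x⁰ − |x̲|, ω)/r` has
`L(r D^m h) = O(r^{-2})`, harmless for `p < 3`.
(ii) *excludes dilute focusing pulses*: an incoming pulse `h = f(x⁰ + |x̲|)/r` crossing the far
layer at radius `S` has sup norm `O(1/S)` but `Lψ₀ = 2f'`, so (b) `≳ S^p ∫|f'|²` GROWS with `S`
(`p > 0`), while outgoing radiation at radius `S` only costs (c) `≈ S^{-1-δ}∫|F'|²`: the norm
penalises exactly the radiation that will focus onto the configuration.
(iii) *comparable to DHRT / KS–GKS for `N = 1`, `Λ = 1`*: (b)+(c) are the `C_u`-flux, and the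
leaf-averaged form of the `r^{-1-δ}` spacetime term, of DHRT's `𝔼^{K,p}` with the flat frame in
place of the double-null frame and the metric deviation in place of `Ψ`; (a) is KS's `sup_{𝓛_int}`
part of `ℑ_k` (unweighted sup norms of `≤ k` derivatives on the near region of a spacetime layer);
KS's `sup_{𝓛_ext} r²|Γ_g|`-type weighted sup control implies the flux bounds for `p < 2`.

## Junk values and scope (documented, not hidden)

* `0 < ℓ` and `0 < Mᵢ` are intended (sub-extremal holes have `Mᵢ > |aᵢ| ≥ 0`). For `ℓ ≤ 0` the
  layer is EMPTY (`layer_eq_bot_of_nonpos`) and the norm of the unique chart is `0`: consumers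
  must quantify `0 < ℓ` (and will want `|ξᵢ| + Mᵢ ≲ ℓ` so that the holes sit in the near part;
  nothing here enforces it). If some `Mᵢ ≤ 0` then `σ ≤ 0` and the derivative weights
  `σ^m`, `σ^{2m}` degenerate (`ENNReal.ofReal` of a nonpositive number is `0`); under the intended
  hypotheses `σ > 0` (`scale_pos`).
* Off `{x̲ ≠ 0}` the flat frame fields carry the junk direction `(1, 0)` (`‖x̲‖⁻¹ = 0`); they are
  only evaluated on the far part `{ℓ ≤ |x̲|}`, `ℓ > 0`. `r^p`, `r^{-1-δ}` are `Real.rpow` of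
  `r ≥ ℓ > 0`. Off the layer `h̃ = 0` (junk of `deviationExtend`), never evaluated.
* The norm is NOT scale-free: under `x ↦ λx` (with `Mᵢ, ξᵢ, τ, ℓ ↦ λ·`) part (a) is invariant,
  (b) scales like `λ^{(p+1)/2}`, (c) like `λ^{-δ/2}`; tolerances `ε₀` therefore depend on `ℓ` and
  the `Mᵢ` (as KS's constants depend on `m₀`), or the consumer fixes `ℓ` from the configuration.
* Not here: any assertion that `G` is Lorentzian or close to a solution (it is a reference form),
  the modulated energy (crux K1 of the route, not a definition), the Landau–Lifshitz superpotential
  (separate request), smoothness/embedding conditions on `Φ` (the consumers state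
  `ContMDiff ∧ IsOpenEmbedding` as in `OrbitsMultiKerr`).

## Mathlib

Mathlib has `iteratedFDeriv`, `fderiv`, `Real.rpow`, the Lebesgue integral `∫⁻ … in s`, Lebesgue
measure on `EuclideanSpace ℝ (Fin 4)` (`measureSpaceOfInnerProductSpace`), `Finset.fold min`,
`TopologicalSpace.Opens`; no null frames, `r^p` energies or Kerr superpositions
(`lean search 'rpFlux|initialLayer|angularGradSq|outgoingNull'`: no declaration). From the tree:
`E4`, `E3`, `E4.spatial`, `E4.ofTimeSpace`, `E4.spatialNorm`, `E4.basisVector` (`Basic`,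
`KerrSchild`), `Kerr.radius/rPlus/rMinus`, `Minkowski.bilin`, `lorentzGroup`, `poincareInv`,
`boostedKerrBilin`, `ModelBackground`, `Spacetime.deviationExtend`, `supCkENorm` (`KerrConvergence`).

## References

* M. Dafermos, I. Rodnianski, *A new physical-space approach to decay for the wave equation with
  applications to black hole spacetimes*, XVIth ICMP (2010) 421–432, arXiv:0910.4957, §3
  (p-WE-Mink), (finalest).
* M. Dafermos, G. Holzegel, I. Rodnianski, M. Taylor, *The non-linear stability of the
  Schwarzschild family of black holes*, arXiv:2104.08222, §I.3 and Ch. 8, §§1.2–1.4 (norms on cones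
  and spacetime regions; energies `𝔼^{K,p}[P_{𝓘⁺}]`).
* S. Klainerman, J. Szeftel, *Kerr stability for small angular momentum*, Pure Appl. Math. Q. 19
  (2023) 791–1678, arXiv:2104.11857, §3.1 (initial data layer) and §3.6 (initial layer norm);
  E. Giorgi, S. Klainerman, J. Szeftel, arXiv:2205.14808, §3.
* G. Moschidis, *The `r^p`-weighted energy method of Dafermos and Rodnianski in general
  asymptotically flat spacetimes and applications*, Ann. PDE 2 (2016), arXiv:1509.08495
  (hyperboloidal foliations).
* M. Dafermos, I. Rodnianski, *Lectures on black holes and linear waves*, arXiv:0811.0354, §5.1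
  (Kerr–Schild coordinates).
-/

noncomputable section

open TopologicalSpace MeasureTheory
open scoped ContDiff Topology ENNReal Manifold

universe u

namespace Literature.Geometry.Lorentzian

/-! ### The flat null frame and angular derivatives on `E4 ∖ {x̲ = 0}` -/

namespace Minkowski

/-- The **radial unit vector** `∂_r = (0, x̲/|x̲|) ∈ E4` at `x` (junk value `(0, 0)` on the time
axis `x̲ = 0`, where `|x̲|⁻¹ = 0`). Dafermos–Rodnianski, arXiv:0910.4957, §3 (polar coordinates
`(t, r, θ, φ)` on Minkowski space). [cite: DafermosRodnianski2010ICMP, §3] -/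
def radialUnit (x : E4) : E4 :=
  E4.ofTimeSpace 0 ((E4.spatialNorm x)⁻¹ • E4.spatial x)

/-- The **outgoing null vector** `L = ∂_t + ∂_r = 2∂_v` of Minkowski space at `x` (the
"good" direction, tangent to the outgoing cones `u = t − r = const`). Dafermos–Rodnianski,
arXiv:0910.4957, §3 (`u = t − r`, `v = t + r`, the flux `∫ r^p (∂_v ψ)²`). [cite: DafermosRodnianski2010ICMP, §3] -/
def outgoingNull (x : E4) : E4 :=
  E4.basisVector 0 + radialUnit x

/-- The **ingoing null vector** `L̲ = ∂_t − ∂_r = 2∂_u` of Minkowski space at `x` (the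
transversal direction to the outgoing cones). Dafermos–Rodnianski, arXiv:0910.4957, §3. [cite: DafermosRodnianski2010ICMP, §3] -/
def ingoingNull (x : E4) : E4 :=
  E4.basisVector 0 - radialUnit x

/-- The **rotation vector field** `Ω_{ij} = xⁱ ∂_j − xʲ ∂_i` (`i, j` spatial indices) of
Minkowski space at `x`; the `Ω_{ij}` span the tangent spaces of the spheres `{t, r = const}` and
`Σ_{i<j} |Ω_{ij} f|² = r² |∇̸ f|²`. Christodoulou–Klainerman 1993, §1 (the rotation generators
`Ω_{(ij)}`); Dafermos–Rodnianski, arXiv:0910.4957, §3 (`∇̸`, the induced derivative on the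
spheres). [cite: DafermosRodnianski2010ICMP, §3] -/
def rotation (i j : Fin 3) (x : E4) : E4 :=
  E4.spatial x i • E4.basisVector j.succ - E4.spatial x j • E4.basisVector i.succ

/-- `Ω_{ii} = 0`. Christodoulou–Klainerman 1993, §1. [cite: DafermosRodnianski2010ICMP, §3] -/
@[simp]
theorem rotation_self (i : Fin 3) (x : E4) : rotation i i x = 0 :=
  sub_self _

/-- `Ω_{ji} = −Ω_{ij}`. Christodoulou–Klainerman 1993, §1. [cite: DafermosRodnianski2010ICMP, §3] -/
theorem rotation_swap (i j : Fin 3) (x : E4) : rotation j i x = -rotation i j x :=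
  (neg_sub _ _).symm

variable {G : Type*} [NormedAddCommGroup G] [NormedSpace ℝ G]

/-- The **squared angular gradient** `|∇̸ f|²(x) := (2|x̲|²)⁻¹ Σ_{i,j} ‖df_x(Ω_{ij})‖²` of a
function `f : E4 → G` into a real normed space (for scalar `f` this is the usual
`|∇̸f|² = |∇_{x̲} f|² − (∂_r f)²`, since `Σ_{i<j} (Ω_{ij}f)² = r²|∇̸f|²`; the symmetric double sum
counts each pair twice, whence the `2`). Junk value at `x̲ = 0` (`|x̲|⁻¹ = 0`): `0`.
Dafermos–Rodnianski, arXiv:0910.4957, §3 (`|∇̸ψ|²`). [cite: DafermosRodnianski2010ICMP, §3] -/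
def angularGradSq (f : E4 → G) (x : E4) : ℝ :=
  (2 * E4.spatialNorm x ^ 2)⁻¹ * ∑ i : Fin 3, ∑ j : Fin 3, ‖fderiv ℝ f x (rotation i j x)‖ ^ 2

/-- The squared angular gradient is nonnegative. Dafermos–Rodnianski, arXiv:0910.4957, §3. [cite: DafermosRodnianski2010ICMP, §3] -/
theorem angularGradSq_nonneg (f : E4 → G) (x : E4) : 0 ≤ angularGradSq f x :=
  mul_nonneg (inv_nonneg.2 (by positivity))
    (Finset.sum_nonneg fun _ _ ↦ Finset.sum_nonneg fun _ _ ↦ sq_nonneg _)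

/-- The angular gradient of the zero function vanishes. Dafermos–Rodnianski, arXiv:0910.4957,
§3. [cite: DafermosRodnianski2010ICMP, §3] -/
@[simp]
theorem angularGradSq_zero (x : E4) : angularGradSq (0 : E4 → G) x = 0 := by
  simp [angularGradSq]

/-- The **radiation field** `ψ := r f`, `r = |x̲|`, of a function `f : E4 → G` (the rescaling
`ψ = rφ` whose good derivative `∂_v ψ` carries the `r^p` weight). Dafermos–Rodnianski,
arXiv:0910.4957, §3 (`ψ := rφ`). [cite: DafermosRodnianski2010ICMP, §3] -/
def radiationField (f : E4 → G) (x : E4) : G :=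
  E4.spatialNorm x • f x

/-- The radiation field of the zero function is zero. Dafermos–Rodnianski, arXiv:0910.4957, §3. [cite: DafermosRodnianski2010ICMP, §3] -/
@[simp]
theorem radiationField_zero : radiationField (0 : E4 → G) = 0 := by
  funext x
  simp [radiationField]

/-- The **`r^p` good-derivative flux density** of `ψ : E4 → G` at `x`, in the DR/DHRT measure
`dv dω` (i.e. to be integrated against `r⁻² ×` coordinate volume):
`r^p ‖dψ_x(L)‖² + |∇̸ψ|²(x) + r⁻² ‖ψ(x)‖²`, `r = |x̲|`, `L = ∂_t + ∂_r`. Dafermos–Rodnianski,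
arXiv:0910.4957, §3 (p-WE-Mink: `∫ r^p (∂_vψ)²`); Dafermos–Holzegel–Rodnianski–Taylor,
arXiv:2104.08222, Ch. 8 §1.4 (`r^p|Ω∇̸₄Ψ|² + r⁻²|r∇̸Ψ|²` on `C_u`, plus the zeroth-order term of
`𝔽^⋆`). [cite: DafermosRodnianski2010ICMP, §3 (p-WE-Mink)] [cite: arXiv210408222, Ch. 8 §1.4] -/
def rpFluxDensity (p : ℝ) (ψ : E4 → G) (x : E4) : ℝ :=
  E4.spatialNorm x ^ p * ‖fderiv ℝ ψ x (outgoingNull x)‖ ^ 2 + angularGradSq ψ x +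
    (E4.spatialNorm x ^ 2)⁻¹ * ‖ψ x‖ ^ 2

/-- The **transversal flux density** `r^{-1-δ} ‖dψ_x(L̲)‖²` of `ψ : E4 → G` at `x`
(`L̲ = ∂_t − ∂_r`; the spacetime weight `r^{-1-δ}` of DHRT's integrated energies).
Dafermos–Holzegel–Rodnianski–Taylor, arXiv:2104.08222, Ch. 8 §1.4 (the term
`r^{-1-δ}|Ω∇̸₃ 𝔇^k Ψ|²`). [cite: arXiv210408222, Ch. 8 §1.4] -/
def transversalFluxDensity (δ : ℝ) (ψ : E4 → G) (x : E4) : ℝ :=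
  E4.spatialNorm x ^ (-1 - δ) * ‖fderiv ℝ ψ x (ingoingNull x)‖ ^ 2

/-- The `r^p` flux density is nonnegative. DR arXiv:0910.4957, §3 ("the left hand side … is
positive definite for `p ≤ 2`"). [cite: DafermosRodnianski2010ICMP, §3] -/
theorem rpFluxDensity_nonneg (p : ℝ) (ψ : E4 → G) (x : E4) : 0 ≤ rpFluxDensity p ψ x :=
  add_nonneg (add_nonneg (mul_nonneg (Real.rpow_nonneg (E4.spatialNorm_nonneg x) _) (sq_nonneg _))
    (angularGradSq_nonneg ψ x)) (mul_nonneg (inv_nonneg.2 (sq_nonneg _)) (sq_nonneg _))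

/-- The transversal flux density is nonnegative. DHRT arXiv:2104.08222, Ch. 8 §1.4. [cite: arXiv210408222, Ch. 8 §1.4] -/
theorem transversalFluxDensity_nonneg (δ : ℝ) (ψ : E4 → G) (x : E4) :
    0 ≤ transversalFluxDensity δ ψ x :=
  mul_nonneg (Real.rpow_nonneg (E4.spatialNorm_nonneg x) _) (sq_nonneg _)

/-- The `r^p` flux density of `ψ = 0` vanishes. DR arXiv:0910.4957, §3. [cite: DafermosRodnianski2010ICMP, §3] -/
@[simp]
theorem rpFluxDensity_zero (p : ℝ) (x : E4) : rpFluxDensity p (0 : E4 → G) x = 0 := by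
  simp [rpFluxDensity]

/-- The transversal flux density of `ψ = 0` vanishes. DHRT arXiv:2104.08222, Ch. 8 §1.4. [cite: arXiv210408222, Ch. 8 §1.4] -/
@[simp]
theorem transversalFluxDensity_zero (δ : ℝ) (x : E4) :
    transversalFluxDensity δ (0 : E4 → G) x = 0 := by
  simp [transversalFluxDensity]

end Minkowski

/-! ### The receding multi-Kerr initial layer -/

namespace RecedingKerr

variable {N : ℕ} (M a : Fin N → ℝ) (Λ : Fin N → lorentzGroup) (ξ : Fin N → E3) (τ ℓ : ℝ)

/-- The **hyperboloidal layer time** `s(x) = x⁰ − τ − (√(ℓ² + |x̲|²) − ℓ)`: `{s = s₀}` is the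
upper unit hyperboloid of curvature radius `ℓ` through `(τ + s₀, 0)`, spacelike and asymptotically
null (`s ≈ x⁰ − τ − |x̲| + ℓ` as `|x̲| → ∞`). The requester's layer is `{0 < s < ℓ}`; hyperboloidal
leaves for the `r^p` method: Moschidis, Ann. PDE 2 (2016), arXiv:1509.08495; the
`{t = τ} ∪ {u = τ − R}` foliation it replaces: DR arXiv:0910.4957, §3. [cite: DafermosRodnianski2010ICMP, §3] -/
def layerTime (τ ℓ : ℝ) (x : E4) : ℝ :=
  x 0 - τ - (√(ℓ ^ 2 + E4.spatialNorm x ^ 2) - ℓ)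

/-- The layer time is continuous on `E4`. DR arXiv:0910.4957, §3. [cite: DafermosRodnianski2010ICMP, §3] -/
theorem continuous_layerTime (τ ℓ : ℝ) : Continuous (layerTime τ ℓ) := by
  unfold layerTime E4.spatialNorm
  fun_prop

/-- On the time axis through the origin, `s(x⁰, 0) = x⁰ − τ`. DR arXiv:0910.4957, §3. [cite: DafermosRodnianski2010ICMP, §3] -/
@[simp]
theorem layerTime_ofTimeSpace_zero (τ ℓ t : ℝ) (hℓ : 0 ≤ ℓ) :
    layerTime τ ℓ (E4.ofTimeSpace t 0) = t - τ := by
  simp [layerTime, Real.sqrt_sq hℓ]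

/-- The **rest-frame Kerr–Schild radius of hole `i`** at the lab point `x`:
`rᵢ(x) = Kerr.radius aᵢ (Λᵢ⁻¹ (x − (τ, ξᵢ)))` (the hole passes through `(τ, ξᵢ)` with motion `Λᵢ`;
`poincareInv`, `boostedKerrBackground.radius` of `KerrConvergence`). Klainerman, "Brief history
of the black hole stability problem", §4 (moving Kerr holes; folklore). [folklore] -/
def holeRadius (i : Fin N) (x : E4) : ℝ :=
  Kerr.radius (a i) (poincareInv (Λ i) (E4.ofTimeSpace τ (ξ i)) x)

/-- Each rest-frame radius is continuous in the lab point. Visser arXiv:0706.0622, (35)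
(continuity of the Kerr–Schild radius) with O'Neill 1983, Ch. 9 (Poincaré maps). [folklore] -/
theorem continuous_holeRadius (i : Fin N) : Continuous (holeRadius a Λ ξ τ i) :=
  (Kerr.continuous_radius _).comp (continuous_poincareInv _ _)

/-- The **initial layer** `𝓛 = {x ∈ E4 | 0 < s(x) < ℓ} ∩ ⋂ᵢ {Mᵢ < rᵢ(x)}` of the receding
multi-Kerr configuration `(Mᵢ, aᵢ, Λᵢ, ξᵢ)` at lab time `τ` and scale `ℓ`, an open subset of `E4`:
the hyperboloidal shell of layer-time thickness `ℓ` above the hyperboloid through `(τ, 0)`, minus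
the cores `{rᵢ ≤ Mᵢ} = {rᵢ ≤ (r₊ + r₋)/2}` (`r₊ + r₋ = 2M`) of the holes. The requester's
`𝓛` verbatim; the template is the initial data layer `𝓛₀ = 𝓛_ext ∪ 𝓛_int` (a spacetime region,
`𝓛_ext` unbounded in the outgoing directions) of Klainerman–Szeftel, arXiv:2104.11857, §3.1.
Empty when `ℓ ≤ 0` (`layer_eq_bot_of_nonpos`). [cite: KlainermanSzeftel2023, §3.1 (initial data layer)] -/
def layer : Opens E4 :=
  ⟨(layerTime τ ℓ ⁻¹' Set.Ioo 0 ℓ) ∩ ⋂ i, {x | M i < holeRadius a Λ ξ τ i x},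
    ((continuous_layerTime τ ℓ).isOpen_preimage _ isOpen_Ioo).inter
      (isOpen_iInter_of_finite fun i ↦
        isOpen_lt continuous_const (continuous_holeRadius a Λ ξ τ i))⟩

/-- Membership in the initial layer: `0 < s(x) < ℓ` and `Mᵢ < rᵢ(x)` for all `i`.
Klainerman–Szeftel, arXiv:2104.11857, §3.1. [cite: KlainermanSzeftel2023, §3.1] -/
@[simp]
theorem mem_layer {x : E4} :
    x ∈ layer M a Λ ξ τ ℓ ↔
      (0 < layerTime τ ℓ x ∧ layerTime τ ℓ x < ℓ) ∧ ∀ i, M i < holeRadius a Λ ξ τ i x := by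
  simp [layer, Set.mem_iInter]

/-- Anti-vacuity flag: for `ℓ ≤ 0` the layer is empty (`0 < s < ℓ` is impossible), so every
statement "`∀ Φ` on the layer, `𝔑(Φ) ≤ ε → …`" is then about the empty chart — consumers quantify
`0 < ℓ`. Klainerman–Szeftel, arXiv:2104.11857, §3.1. [cite: KlainermanSzeftel2023, §3.1] -/
theorem layer_eq_bot_of_nonpos (hℓ : ℓ ≤ 0) : layer M a Λ ξ τ ℓ = ⊥ := by
  refine le_bot_iff.1 fun x hx ↦ ?_
  have h := (mem_layer M a Λ ξ τ ℓ).1 hx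
  exact ((not_lt.2 hℓ) (h.1.1.trans h.1.2)).elim

/-- Non-vacuity: with no hole (`N = 0`) and `0 < ℓ`, the point `(τ + ℓ/2, 0)` lies in the layer.
Klainerman–Szeftel, arXiv:2104.11857, §3.1. [cite: KlainermanSzeftel2023, §3.1] -/
theorem ofTimeSpace_mem_layer_of_isEmpty [IsEmpty (Fin N)] (hℓ : 0 < ℓ) :
    E4.ofTimeSpace (τ + ℓ / 2) 0 ∈ layer M a Λ ξ τ ℓ := by
  rw [mem_layer, layerTime_ofTimeSpace_zero _ _ _ hℓ.le]
  exact ⟨⟨by linarith, by linarith⟩, fun i ↦ isEmptyElim i⟩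

/-- The **reference background of the layer**: domain `𝓛`, reference form the superposed
boosted Kerr–Schild ansatz `G(x) = η + Σᵢ (boostedKerrBilin Λᵢ (τ, ξᵢ) Mᵢ aᵢ x − η)` (inline, as in
the route's typed cruxes; the `N`-centre Kerr–Schild superposition with centres `(τ, ξᵢ)` — a
REFERENCE FORM, not asserted Lorentzian or vacuum), time function the layer time `s` (so
`timeSlab s₀` is the hyperboloidal leaf `{s = s₀}`), radius `|x̲|`. Kerr–Schild 1965 (Lorentz
covariance of the Kerr–Schild form); the `N`-hole far-zone skeleton of the final state picture,
Klainerman, "Brief history …", §4 (folklore; no printed formulation). [folklore] -/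
def background : ModelBackground where
  domain := layer M a Λ ξ τ ℓ
  bilin x := Minkowski.bilin +
    ∑ i, (boostedKerrBilin (Λ i) (E4.ofTimeSpace τ (ξ i)) (M i) (a i) x - Minkowski.bilin)
  time := layerTime τ ℓ
  radius := E4.spatialNorm

/-- The domain of the layer background is the layer (by `rfl`). [folklore] -/
@[simp]
theorem background_domain : (background M a Λ ξ τ ℓ).domain = layer M a Λ ξ τ ℓ := rfl

/-- Unfolding lemma for the reference form: `G(x)(v, w) = η(v, w) + Σᵢ (g_{Kerr,i}(x)(v, w) −
η(v, w))`. Kerr–Schild 1965. [cite: KerrSchild1965] -/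
theorem background_bilin_apply (x v w : E4) :
    (background M a Λ ξ τ ℓ).bilin x v w = Minkowski.bilin v w +
      ∑ i, (boostedKerrBilin (Λ i) (E4.ofTimeSpace τ (ξ i)) (M i) (a i) x v w -
        Minkowski.bilin v w) := by
  simp [background]

/-- Sanity (`N = 0`): with no hole the reference form is the Minkowski form `η`.
O'Neill 1983, Ch. 3, p. 55. [cite: ONeill1983, Ch. 3  p. 55] -/
theorem background_bilin_of_isEmpty [IsEmpty (Fin N)] (x : E4) :
    (background M a Λ ξ τ ℓ).bilin x = Minkowski.bilin := by
  simp [background]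

/-- The time slabs of the layer background are the hyperboloidal leaves `{x ∈ 𝓛 | s(x) = s₀}`.
Moschidis, Ann. PDE 2 (2016), arXiv:1509.08495 (hyperboloidal foliations for the `r^p` method). [cite: Moschidis2016, §1 (hyperboloidal foliations)] -/
theorem mem_timeSlab_background {s₀ : ℝ} {x : (background M a Λ ξ τ ℓ).domain} :
    x ∈ (background M a Λ ξ τ ℓ).timeSlab s₀ ↔ layerTime τ ℓ x.1 = s₀ :=
  Iff.rfl

/-- The **near part** `𝓛 ∩ {|x̲| ≤ ℓ}` of the layer (where the `Cᵏ` sup norm (a) is taken), as a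
subset of `E4`. Klainerman–Szeftel, arXiv:2104.11857, §3.1 (`𝓛_int`). [cite: KlainermanSzeftel2023, §3.1 (𝓛_int)] -/
def nearLayer : Set E4 :=
  {x | x ∈ layer M a Λ ξ τ ℓ ∧ E4.spatialNorm x ≤ ℓ}

/-- The **far (outgoing) part** `𝓛 ∩ {ℓ ≤ |x̲|}` of the layer (where the fluxes (b), (c) are
taken), as a subset of `E4`. Klainerman–Szeftel, arXiv:2104.11857, §3.1 (`𝓛_ext`, unbounded in the
outgoing directions). [cite: KlainermanSzeftel2023, §3.1 (𝓛_ext)] -/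
def farLayer : Set E4 :=
  {x | x ∈ layer M a Λ ξ τ ℓ ∧ ℓ ≤ E4.spatialNorm x}

/-- The layer is the union of its near and far parts. KS arXiv:2104.11857, §3.1
(`𝓛₀ = 𝓛_ext ∪ 𝓛_int`). [cite: KlainermanSzeftel2023, §3.1] -/
theorem nearLayer_union_farLayer :
    nearLayer M a Λ ξ τ ℓ ∪ farLayer M a Λ ξ τ ℓ = (layer M a Λ ξ τ ℓ : Set E4) := by
  ext x
  simp only [nearLayer, farLayer, Set.mem_union, Set.mem_setOf_eq, SetLike.mem_coe]
  constructor
  · rintro (h | h) <;> exact h.1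
  · intro h
    rcases le_total (E4.spatialNorm x) ℓ with h' | h'
    exacts [Or.inl ⟨h, h'⟩, Or.inr ⟨h, h'⟩]

/-- On the far part the spatial radius is at least `ℓ` (so for `0 < ℓ` the flat frame and the
weights `r^p`, `r^{-1-δ}` are evaluated off the time axis). KS arXiv:2104.11857, §3.1. [cite: KlainermanSzeftel2023, §3.1] -/
theorem le_spatialNorm_of_mem_farLayer {x : E4} (hx : x ∈ farLayer M a Λ ξ τ ℓ) :
    ℓ ≤ E4.spatialNorm x :=
  hx.2

/-- The **scale** `σ = min(ℓ, minᵢ Mᵢ)` weighting the `m`-th derivative by `σ^m` (the request's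
`σ`; `Finset.fold min ℓ M`, so `σ = ℓ` when `N = 0`). Route EIHFluxBalance, definition request
(no printed source). [folklore] -/
def scale (M : Fin N → ℝ) (ℓ : ℝ) : ℝ :=
  Finset.univ.fold min ℓ M

/-- `σ ≤ ℓ`. [folklore] -/
theorem scale_le : scale M ℓ ≤ ℓ :=
  (Finset.fold_min_le _).2 (Or.inl le_rfl)

/-- `σ ≤ Mᵢ` for every hole. [folklore] -/
theorem scale_le_mass (i : Fin N) : scale M ℓ ≤ M i :=
  (Finset.fold_min_le _).2 (Or.inr ⟨i, Finset.mem_univ i, le_rfl⟩)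

/-- `c ≤ σ ↔ c ≤ ℓ ∧ ∀ i, c ≤ Mᵢ`: `σ` is the minimum of `ℓ` and the masses. [folklore] -/
theorem le_scale_iff {c : ℝ} : c ≤ scale M ℓ ↔ c ≤ ℓ ∧ ∀ i, c ≤ M i := by
  simp [scale, Finset.le_fold_min]

/-- `σ > 0` as soon as `ℓ > 0` and all masses are positive. [folklore] -/
theorem scale_pos (hℓ : 0 < ℓ) (hM : ∀ i, 0 < M i) : 0 < scale M ℓ := by
  simp [scale, Finset.lt_fold_min, hℓ, hM]

/-- With no hole, `σ = ℓ`. [folklore] -/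
@[simp]
theorem scale_of_isEmpty [IsEmpty (Fin N)] : scale M ℓ = ℓ := by
  simp [scale, Finset.univ_eq_empty]

variable {G : Type*} [NormedAddCommGroup G] [NormedSpace ℝ G]

/-- (a) The **near `Cᵏ` norm** `Σ_{m ≤ k} σ^m · sup_{x ∈ 𝓛, |x̲| ≤ ℓ} ‖D^m f(x)‖ ∈ [0, ∞]` of
`f : E4 → G` (the request's (a), with Mathlib's `iteratedFDeriv`; only `f` smooth on the open
layer are intended). Template: the unweighted `sup_{𝓛_int} |𝔡^{≤k}(Γ_g, Γ_b)|` part of the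
initial layer norm `ℑ_k` of Klainerman–Szeftel, arXiv:2104.11857, §3.6; cf. `supCkENorm`
(`KerrConvergence`). [cite: KlainermanSzeftel2023, §3.6 (initial layer norm, 𝓛_int part)] -/
def nearCkNorm (k : ℕ) (f : E4 → G) : ℝ≥0∞ :=
  ∑ m ∈ Finset.range (k + 1), ENNReal.ofReal (scale M ℓ ^ m) *
    ⨆ x ∈ nearLayer M a Λ ξ τ ℓ, ‖iteratedFDeriv ℝ m f x‖ₑ

/-- (b) The **`r^p`-weighted good-derivative flux** of `f : E4 → G` through the far part of the
layer: `Σ_{m ≤ k} σ^{2m} ℓ⁻¹ ∫_{x ∈ 𝓛, ℓ ≤ |x̲|} r⁻² (r^p ‖L ψ_m‖² + |∇̸ ψ_m|² + r⁻² ‖ψ_m‖²) d⁴x ∈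
[0, ∞]`, `ψ_m = r • D^m f` (`Minkowski.radiationField`, `Minkowski.rpFluxDensity`), Lebesgue measure
on `E4`. The factor `r⁻²/ℓ` turns the layer integral into the average over the hyperboloidal leaves
of the leaf fluxes in the DR/DHRT measure `dv dω` (module docstring). Dafermos–Rodnianski,
arXiv:0910.4957, §3 (p-WE-Mink); DHRT arXiv:2104.08222, Ch. 8 §1.4 (`𝔼^{K,p}[P_{𝓘⁺}]`,
commuted with `𝔇^k`). [cite: DafermosRodnianski2010ICMP, §3 (p-WE-Mink)] [cite: arXiv210408222, Ch. 8 §1.4] -/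
def rpFlux (k : ℕ) (p : ℝ) (f : E4 → G) : ℝ≥0∞ :=
  ∑ m ∈ Finset.range (k + 1), ENNReal.ofReal (scale M ℓ ^ (2 * m)) * ENNReal.ofReal ℓ⁻¹ *
    ∫⁻ x in farLayer M a Λ ξ τ ℓ, ENNReal.ofReal ((E4.spatialNorm x ^ 2)⁻¹ *
      Minkowski.rpFluxDensity p (Minkowski.radiationField (iteratedFDeriv ℝ m f)) x)

/-- (c) The **transversal energy flux** of `f : E4 → G` through the far part of the layer:
`Σ_{m ≤ k} σ^{2m} ℓ⁻¹ ∫_{x ∈ 𝓛, ℓ ≤ |x̲|} r⁻² · r^{-1-δ} ‖L̲ ψ_m‖² d⁴x ∈ [0, ∞]`, `ψ_m = r • D^m f`.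
DHRT arXiv:2104.08222, Ch. 8 §1.4 (the `r^{-1-δ}|Ω∇̸₃𝔇^kΨ|²` term of `𝔼^{K,p}[P_{𝓘⁺}]`). [cite: arXiv210408222, Ch. 8 §1.4] -/
def transversalFlux (k : ℕ) (δ : ℝ) (f : E4 → G) : ℝ≥0∞ :=
  ∑ m ∈ Finset.range (k + 1), ENNReal.ofReal (scale M ℓ ^ (2 * m)) * ENNReal.ofReal ℓ⁻¹ *
    ∫⁻ x in farLayer M a Λ ξ τ ℓ, ENNReal.ofReal ((E4.spatialNorm x ^ 2)⁻¹ *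
      Minkowski.transversalFluxDensity δ (Minkowski.radiationField (iteratedFDeriv ℝ m f)) x)

/-- The near norm of `f = 0` vanishes (exact configurations have norm zero). KS
arXiv:2104.11857, §3.6. [cite: KlainermanSzeftel2023, §3.6] -/
@[simp]
theorem nearCkNorm_zero (k : ℕ) : nearCkNorm M a Λ ξ τ ℓ k (0 : E4 → G) = 0 := by
  simp [nearCkNorm, enorm_eq_nnnorm]

/-- The `r^p` flux of `f = 0` vanishes. DR arXiv:0910.4957, §3. [cite: DafermosRodnianski2010ICMP, §3] -/
@[simp]
theorem rpFlux_zero (k : ℕ) (p : ℝ) : rpFlux M a Λ ξ τ ℓ k p (0 : E4 → G) = 0 := by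
  simp [rpFlux]

/-- The transversal flux of `f = 0` vanishes. DHRT arXiv:2104.08222, Ch. 8 §1.4. [cite: arXiv210408222, Ch. 8 §1.4] -/
@[simp]
theorem transversalFlux_zero (k : ℕ) (δ : ℝ) :
    transversalFlux M a Λ ξ τ ℓ k δ (0 : E4 → G) = 0 := by
  simp [transversalFlux]

/-- The near norm is monotone in the number of derivatives. KS arXiv:2104.11857, §3.6. [cite: KlainermanSzeftel2023, §3.6] -/
theorem nearCkNorm_mono {k k' : ℕ} (h : k ≤ k') (f : E4 → G) :
    nearCkNorm M a Λ ξ τ ℓ k f ≤ nearCkNorm M a Λ ξ τ ℓ k' f :=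
  Finset.sum_le_sum_of_subset (Finset.range_mono (Nat.succ_le_succ h))

/-- The `r^p` flux is monotone in the number of derivatives. DHRT arXiv:2104.08222, Ch. 8 §1.4. [cite: arXiv210408222, Ch. 8 §1.4] -/
theorem rpFlux_mono {k k' : ℕ} (h : k ≤ k') (p : ℝ) (f : E4 → G) :
    rpFlux M a Λ ξ τ ℓ k p f ≤ rpFlux M a Λ ξ τ ℓ k' p f :=
  Finset.sum_le_sum_of_subset (Finset.range_mono (Nat.succ_le_succ h))

/-- The transversal flux is monotone in the number of derivatives. DHRT arXiv:2104.08222,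
Ch. 8 §1.4. [cite: arXiv210408222, Ch. 8 §1.4] -/
theorem transversalFlux_mono {k k' : ℕ} (h : k ≤ k') (δ : ℝ) (f : E4 → G) :
    transversalFlux M a Λ ξ τ ℓ k δ f ≤ transversalFlux M a Λ ξ τ ℓ k' δ f :=
  Finset.sum_le_sum_of_subset (Finset.range_mono (Nat.succ_le_succ h))

end RecedingKerr

/-! ### The norm -/

namespace Spacetime

variable (𝓢 : Spacetime.{u} 4) {N : ℕ} (M a : Fin N → ℝ) (Λ : Fin N → lorentzGroup)
  (ξ : Fin N → E3) (τ ℓ : ℝ)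

/-- The **receding-Kerr initial-layer norm** `𝔑(Φ) ∈ [0, ∞]` of a chart
`Φ : 𝓛 → 𝓢.carrier` of the spacetime `𝓢` on the initial layer `𝓛 = RecedingKerr.layer M a Λ ξ τ ℓ`
of the configuration `(Mᵢ, aᵢ, Λᵢ, ξᵢ)` at lab time `τ` and scale `ℓ`, with exponents
`(k, p, δ)`: writing `h̃ = deviationExtend` of `Φ^* g − G` (`G` the superposed boosted Kerr–Schild
form of `RecedingKerr.background`),
`𝔑(Φ) = nearCkNorm k h̃ + (rpFlux k p h̃)^{1/2} + (transversalFlux k δ h̃)^{1/2}` — (a) the near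
`Cᵏ` sup norm `Σ_{m≤k} σ^m sup_{𝓛 ∩ {|x̲| ≤ ℓ}} ‖D^m h̃‖`, (b) the leaf-averaged `r^p`-weighted
good-derivative flux and (c) the transversal flux of `ψ_m = r D^m h̃`, `m ≤ k`, through
`𝓛 ∩ {|x̲| ≥ ℓ}` (square roots: `𝔑` is degree-one homogeneous in the deviation). Recommended
exponents `k ≥ 6`, `1 < p < 2`, `0 < δ`; intended for `0 < ℓ` (empty layer otherwise) and smooth
open embeddings `Φ`. Route-posited notion (FinalStateConjecture/EIHFluxBalance, no printed
formulation for `N ≥ 2`); templates: Dafermos–Rodnianski arXiv:0910.4957, §3;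
Dafermos–Holzegel–Rodnianski–Taylor arXiv:2104.08222, Ch. 8 §1.4; Klainerman–Szeftel
arXiv:2104.11857, §3.6 (module docstring, "Checks"). [cite: DafermosRodnianski2010ICMP, §3 (p-WE-Mink)]
[cite: arXiv210408222, Ch. 8 §1.4] [cite: KlainermanSzeftel2023, §3.6] -/
def recedingKerrInitialLayerNorm (k : ℕ) (p δ : ℝ)
    (Φ : RecedingKerr.layer M a Λ ξ τ ℓ → 𝓢.carrier) : ℝ≥0∞ :=
  RecedingKerr.nearCkNorm M a Λ ξ τ ℓ k
      (𝓢.deviationExtend (RecedingKerr.background M a Λ ξ τ ℓ) Φ) +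
    RecedingKerr.rpFlux M a Λ ξ τ ℓ k p
        (𝓢.deviationExtend (RecedingKerr.background M a Λ ξ τ ℓ) Φ) ^ (1 / 2 : ℝ) +
      RecedingKerr.transversalFlux M a Λ ξ τ ℓ k δ
          (𝓢.deviationExtend (RecedingKerr.background M a Λ ξ τ ℓ) Φ) ^ (1 / 2 : ℝ)

/-- Unfolding lemma: `𝔑 = (a) + (b)^{1/2} + (c)^{1/2}` at `h̃ = deviationExtend (background …) Φ`.
DR arXiv:0910.4957, §3; DHRT arXiv:2104.08222, Ch. 8 §1.4; KS arXiv:2104.11857, §3.6. [cite: DafermosRodnianski2010ICMP, §3] -/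
theorem recedingKerrInitialLayerNorm_eq (k : ℕ) (p δ : ℝ)
    (Φ : RecedingKerr.layer M a Λ ξ τ ℓ → 𝓢.carrier) :
    𝓢.recedingKerrInitialLayerNorm M a Λ ξ τ ℓ k p δ Φ =
      RecedingKerr.nearCkNorm M a Λ ξ τ ℓ k
          (𝓢.deviationExtend (RecedingKerr.background M a Λ ξ τ ℓ) Φ) +
        RecedingKerr.rpFlux M a Λ ξ τ ℓ k p
            (𝓢.deviationExtend (RecedingKerr.background M a Λ ξ τ ℓ) Φ) ^ (1 / 2 : ℝ) +
          RecedingKerr.transversalFlux M a Λ ξ τ ℓ k δ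
              (𝓢.deviationExtend (RecedingKerr.background M a Λ ξ τ ℓ) Φ) ^ (1 / 2 : ℝ) :=
  rfl

/-- Each of the three parts is dominated by the norm: (a) the near `Cᵏ` norm. KS
arXiv:2104.11857, §3.6. [cite: KlainermanSzeftel2023, §3.6] -/
theorem nearCkNorm_le_recedingKerrInitialLayerNorm (k : ℕ) (p δ : ℝ)
    (Φ : RecedingKerr.layer M a Λ ξ τ ℓ → 𝓢.carrier) :
    RecedingKerr.nearCkNorm M a Λ ξ τ ℓ k
        (𝓢.deviationExtend (RecedingKerr.background M a Λ ξ τ ℓ) Φ) ≤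
      𝓢.recedingKerrInitialLayerNorm M a Λ ξ τ ℓ k p δ Φ :=
  le_add_right le_self_add

/-- (b) the square root of the `r^p` flux is dominated by the norm. DR arXiv:0910.4957, §3. [cite: DafermosRodnianski2010ICMP, §3] -/
theorem rpFlux_rpow_le_recedingKerrInitialLayerNorm (k : ℕ) (p δ : ℝ)
    (Φ : RecedingKerr.layer M a Λ ξ τ ℓ → 𝓢.carrier) :
    RecedingKerr.rpFlux M a Λ ξ τ ℓ k p
        (𝓢.deviationExtend (RecedingKerr.background M a Λ ξ τ ℓ) Φ) ^ (1 / 2 : ℝ) ≤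
      𝓢.recedingKerrInitialLayerNorm M a Λ ξ τ ℓ k p δ Φ :=
  le_add_right le_add_self

/-- (c) the square root of the transversal flux is dominated by the norm. DHRT arXiv:2104.08222,
Ch. 8 §1.4. [cite: arXiv210408222, Ch. 8 §1.4] -/
theorem transversalFlux_rpow_le_recedingKerrInitialLayerNorm (k : ℕ) (p δ : ℝ)
    (Φ : RecedingKerr.layer M a Λ ξ τ ℓ → 𝓢.carrier) :
    RecedingKerr.transversalFlux M a Λ ξ τ ℓ k δ
        (𝓢.deviationExtend (RecedingKerr.background M a Λ ξ τ ℓ) Φ) ^ (1 / 2 : ℝ) ≤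
      𝓢.recedingKerrInitialLayerNorm M a Λ ξ τ ℓ k p δ Φ :=
  le_add_self

/-- The norm is monotone in the number of derivatives `k`. DHRT arXiv:2104.08222, Ch. 8 §1.4. [cite: arXiv210408222, Ch. 8 §1.4] -/
theorem recedingKerrInitialLayerNorm_mono {k k' : ℕ} (h : k ≤ k') (p δ : ℝ)
    (Φ : RecedingKerr.layer M a Λ ξ τ ℓ → 𝓢.carrier) :
    𝓢.recedingKerrInitialLayerNorm M a Λ ξ τ ℓ k p δ Φ ≤
      𝓢.recedingKerrInitialLayerNorm M a Λ ξ τ ℓ k' p δ Φ := by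
  unfold recedingKerrInitialLayerNorm
  gcongr
  · exact RecedingKerr.nearCkNorm_mono M a Λ ξ τ ℓ h _
  · exact RecedingKerr.rpFlux_mono M a Λ ξ τ ℓ h p _
  · exact RecedingKerr.transversalFlux_mono M a Λ ξ τ ℓ h δ _

/-- Smallness of the norm controls the pointwise near-zone derivatives: for `m ≤ k` and `x` in
the near part of the layer, `σ^m ‖D^m h̃(x)‖ ≤ 𝔑(Φ)`. KS arXiv:2104.11857, §3.6. [cite: KlainermanSzeftel2023, §3.6] -/
theorem ofReal_mul_enorm_iteratedFDeriv_le_recedingKerrInitialLayerNorm {k m : ℕ} (hm : m ≤ k)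
    (p δ : ℝ) (Φ : RecedingKerr.layer M a Λ ξ τ ℓ → 𝓢.carrier) {x : E4}
    (hx : x ∈ RecedingKerr.nearLayer M a Λ ξ τ ℓ) :
    ENNReal.ofReal (RecedingKerr.scale M ℓ ^ m) *
        ‖iteratedFDeriv ℝ m (𝓢.deviationExtend (RecedingKerr.background M a Λ ξ τ ℓ) Φ) x‖ₑ ≤
      𝓢.recedingKerrInitialLayerNorm M a Λ ξ τ ℓ k p δ Φ := by
  refine le_trans ?_ (𝓢.nearCkNorm_le_recedingKerrInitialLayerNorm M a Λ ξ τ ℓ k p δ Φ)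
  unfold RecedingKerr.nearCkNorm
  refine le_trans ?_
    (Finset.single_le_sum (fun _ _ ↦ zero_le) (Finset.mem_range.2 (Nat.lt_succ_of_le hm)))
  gcongr
  exact le_iSup₂_of_le x hx le_rfl

end Spacetime

/-! ### Bridge to the generic scaled `Cᵏ` norm (`ShellDeviation`) -/

namespace RecedingKerr

variable {N : ℕ} (M a : Fin N → ℝ) (Λ : Fin N → lorentzGroup) (ξ : Fin N → E3) (τ ℓ : ℝ)
  {G : Type*} [NormedAddCommGroup G] [NormedSpace ℝ G]

/-- **Bridge**: the near `Cᵏ` norm (a) is the generic scaled `Cᵏ` norm `scaleCkENorm`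
(`ShellDeviation`) over the near layer at the scale `σ = scale M ℓ` — definitionally — so the
`scaleCkENorm` API (monotonicity in the set, the order and the scale, pointwise bounds,
comparison with `supCkENorm`, exactness lemmas) applies to it verbatim. KS arXiv:2104.11857,
§3.6 (initial layer norm, `𝓛_int` part). [cite: KlainermanSzeftel2023, §3.6] -/
theorem nearCkNorm_eq_scaleCkENorm (k : ℕ) (f : E4 → G) :
    nearCkNorm M a Λ ξ τ ℓ k f = scaleCkENorm (nearLayer M a Λ ξ τ ℓ) k (scale M ℓ) f :=
  rfl

/-- Pointwise reading of a near-norm bound through the bridge: `σ^m ‖D^m f(x)‖ ≤ nearCkNorm … k f`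
for `m ≤ k` and `x` in the near layer. KS arXiv:2104.11857, §3.6.
[cite: KlainermanSzeftel2023, §3.6] -/
theorem ofReal_mul_enorm_iteratedFDeriv_le_nearCkNorm {k m : ℕ} (hm : m ≤ k) {x : E4}
    (hx : x ∈ nearLayer M a Λ ξ τ ℓ) (f : E4 → G) :
    ENNReal.ofReal (scale M ℓ ^ m) * ‖iteratedFDeriv ℝ m f x‖ₑ ≤ nearCkNorm M a Λ ξ τ ℓ k f :=
  ofReal_mul_enorm_iteratedFDeriv_le_scaleCkENorm hm hx _ f

/-- Exactness through the bridge: if `f` vanishes on an open neighbourhood of the near layer, its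
near `Cᵏ` norm is `0` (so an exactly multi-Kerr–Schild near layer has vanishing part (a)).
KS arXiv:2104.11857, §3.6. [cite: KlainermanSzeftel2023, §3.6] -/
theorem nearCkNorm_eq_zero_of_eqOn {V : Set E4} (hV : IsOpen V)
    (hsub : nearLayer M a Λ ξ τ ℓ ⊆ V) {f : E4 → G} (hf : Set.EqOn f 0 V) (k : ℕ) :
    nearCkNorm M a Λ ξ τ ℓ k f = 0 :=
  scaleCkENorm_eq_zero_of_eqOn hV hsub hf k _

end RecedingKerr

end Literature.Geometry.Lorentzian

end
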